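import Summits.ResolutionOfSingularities.ResolutionOfSingularities.Theorems.SectionAscentAffineToGlobalYardstickCharts
import HarnessLib

/-!
# Crux `AffineToGlobal` (stmt-ResolutionOfSingularities-15961), line `Sketch`: yardstick charts
# from WEAK affine resolutions over ONE field

Route `ResolutionOfSingularities/SectionAscent`, crux `AffineToGlobal`. Support file
(`--supports stmt-ResolutionOfSingularities-15961`). The landed `YardstickCharts.stub_yardstickCharts`
(p166995) builds the yardstick charts and their join from the crux's hypothesis H (affine
`Sing`-exact one-shots in characteristic `p`, all fields, all dimensions) but USES only its weak
part on the charts of the given variety. This file records the construction under exactly what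
it consumes: for ONE field `K` (any characteristic), the hypothesis

  `hweak`: every integral `K`-algebra of finite type `A` has an ideal `I ≠ 0` with
  `Bl_I(Spec A)` regular (equivalently: every affine `K`-variety has a projective resolution of
  singularities, with no condition over its regular locus)

— so that the line's global theorem can be stated field by field and with weak resolutions of
affine varieties as input (`PhasedYardstick.hasResolution_of_affineBlowupResolutions`).
Construction verbatim as in the landed file: a finite cover by non-empty affine opens `U i`,
`T i = Spec Γ(Y, U i)`, `R i = Bl_{I i}(T i)` from `hweak`, `J = ∏ i (𝓘 i).map (φ i)`, `σ₀` a
blow-up along `J`, and Stacks 07ZV for the effective Cartier clause.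

Sources: The Stacks Project, Tags 080A, 07ZV [StacksProject]; M. Temkin, Adv. Math. 219 (2008),
§2.1 [Temkin2008].
-/

noncomputable section

set_option linter.dupNamespace false -- mandated namespace of this single-conjunct summit

open CategoryTheory CategoryTheory.Limits AlgebraicGeometry TopologicalSpace
open Literature.AlgebraicGeometry.Resolution

namespace Summit.ResolutionOfSingularities.ResolutionOfSingularities.Theorems.AffineToGlobal.YardstickChartsWeak

/-- **Weak affine resolutions on an affine chart.** If every integral `K`-algebra of finite type
has a non-zero ideal with regular blow-up, then so does `Γ(Y, U)` for every non-empty affine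
open `U` of an integral scheme `Y` locally of finite type over `K`. [folklore] -/
theorem exists_ideal_isRegular_affineBlowup (K : Type) [Field K]
    (hweak : ∀ (A : Type) [CommRing A] [IsDomain A] [Algebra K A] [Algebra.FiniteType K A],
      ∃ I : Ideal A, I ≠ ⊥ ∧ Scheme.IsRegular (affineBlowup I))
    (Y : Scheme.{0}) [IsIntegral Y] (f : Y ⟶ Spec (.of K)) [LocallyOfFiniteType f]
    (U : Y.Opens) (hU : IsAffineOpen U) [Nonempty U] :
    ∃ I : Ideal Γ(Y, U), I ≠ ⊥ ∧ Scheme.IsRegular (affineBlowup I) := by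
  haveI : IsDomain Γ(Y, U) := IsIntegral.component_integral U
  letI : Algebra K Γ(Y, U) :=
    ((f.appLE ⊤ U le_top).hom.comp (Scheme.ΓSpecIso (.of K)).inv.hom).toAlgebra
  haveI : Algebra.FiniteType K Γ(Y, U) := by
    have hft : RingHom.FiniteType (f.appLE ⊤ U le_top).hom :=
      HasRingHomProperty.appLE @LocallyOfFiniteType f inferInstance ⟨⊤, isAffineOpen_top _⟩
        ⟨U, hU⟩ le_top
    exact hft.comp (RingHom.FiniteType.of_surjective _
      (Scheme.ΓSpecIso (.of K)).commRingCatIsoToRingEquiv.symm.surjective)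
  exact hweak Γ(Y, U)

/-- **Yardstick charts and their join from weak affine resolutions over one field.** Let `K`
be a field such that every integral `K`-algebra of finite type has a non-zero ideal with regular
blow-up. For `Y` integral of finite type over `K` there are finitely many open charts
`φ i : T i ↪ Y` covering `Y`, blow-ups `b i : R i → T i` along `𝓘 i` with every `R i` a regular
integral `K`-scheme of finite type, and a blow-up `σ₀ : S₀ → Y` along a non-zero ideal sheaf `J`
such that every extended centre `(𝓘 i).map (φ i)` pulls back along `σ₀` to an effective Cartier
divisor (same construction as `YardstickCharts.stub_yardstickCharts`).
[cite: StacksProject, Tag 07ZV] -/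
theorem yardstickCharts_of_affineBlowupResolutions (K : Type) [Field K]
    (hweak : ∀ (A : Type) [CommRing A] [IsDomain A] [Algebra K A] [Algebra.FiniteType K A],
      ∃ I : Ideal A, I ≠ ⊥ ∧ Scheme.IsRegular (affineBlowup I))
    (Y : Scheme.{0}) [IsIntegral Y] (f : Y ⟶ Spec (.of K)) [LocallyOfFiniteType f]
    [QuasiCompact f] :
    ∃ (n : ℕ) (T R : Fin n → Scheme.{0}) (φ : ∀ i, T i ⟶ Y) (_ : ∀ i, IsOpenImmersion (φ i))
      (b : ∀ i, R i ⟶ T i) (𝓘 : ∀ i, (T i).IdealSheafData) (fR : ∀ i, R i ⟶ Spec (.of K))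
      (_ : ∀ i, IsIntegral (R i)) (_ : ∀ i, LocallyOfFiniteType (fR i))
      (_ : ∀ i, QuasiCompact (fR i)) (S₀ : Scheme.{0}) (σ₀ : S₀ ⟶ Y) (J : Y.IdealSheafData),
      (∀ y : Y, ∃ i, y ∈ Set.range (φ i)) ∧ (∀ i, IsBlowup (b i) (𝓘 i)) ∧
      (∀ i, Scheme.IsRegular (R i)) ∧ J ≠ ⊥ ∧ IsBlowup σ₀ J ∧
      ∀ i, IsEffectiveCartier (((𝓘 i).map (φ i)).comap σ₀) := by
  classical
  haveI : IsLocallyNoetherian Y := LocallyOfFiniteType.isLocallyNoetherian f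
  haveI : CompactSpace Y := QuasiCompact.compactSpace_of_compactSpace f
  haveI : IsNoetherian Y := {}
  -- a finite cover of `Y` by non-empty affine opens `U i`, indexed by `Fin n`
  let 𝒰 := Y.affineCover.finiteSubcover
  let n : ℕ := Fintype.card 𝒰.I₀
  let e : 𝒰.I₀ ≃ Fin n := Fintype.equivFin 𝒰.I₀
  let U : Fin n → Y.Opens := fun i => (𝒰.f (e.symm i)).opensRange
  have hU : ∀ i, IsAffineOpen (U i) := fun i => isAffineOpen_opensRange (𝒰.f (e.symm i))
  have hmem : ∀ i : Fin n, (e.symm i).1 ∈ U i := fun i => Y.affineCover.covers (e.symm i).1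
  haveI : ∀ i, Nonempty (U i) := fun i => ⟨⟨(e.symm i).1, hmem i⟩⟩
  have hcover : ∀ y : Y, ∃ i, y ∈ U i := fun y => by
    have hy : y ∈ (⊤ : Y.Opens) := trivial
    rw [← 𝒰.iSup_opensRange, Opens.mem_iSup] at hy
    obtain ⟨j, hj⟩ := hy
    refine ⟨e j, ?_⟩
    have hj' : e.symm (e j) = j := e.symm_apply_apply j
    change y ∈ (𝒰.f (e.symm (e j))).opensRange
    rw [hj']
    exact hj
  -- chartwise blow-up resolutions `R i = Bl_{I i}(Spec Γ(Y, U i))` (hypothesis `hweak`)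
  choose I hI hreg using fun i =>
    exists_ideal_isRegular_affineBlowup K hweak Y f (U i) (hU i)
  -- the charts `φ i`, the centres `𝓘 i = Ĩ_i` and their largest extensions `Jc i` to `Y`
  let φ : ∀ i, Spec Γ(Y, U i) ⟶ Y := fun i => (hU i).fromSpec
  let 𝓘 : ∀ i, (Spec Γ(Y, U i)).IdealSheafData := fun i => affineBlowup.idealSheaf (I i)
  let Jc : Fin n → Y.IdealSheafData := fun i => (𝓘 i).map (φ i)
  have hJφ : ∀ i, (Jc i).comap (φ i) = 𝓘 i := fun i =>
    Literature.AlgebraicGeometry.Limits.comap_map_of_isOpenImmersion (φ i) (𝓘 i)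
  have hJc : ∀ i, Jc i ≠ ⊥ := fun i hi => by
    have h1 := hJφ i
    rw [hi, Scheme.IdealSheafData.comap_bot] at h1
    exact affineBlowup.idealSheaf_ne_bot (hI i) h1.symm
  -- the join: `J = ∏ Jc i ≠ 0` and a blow-up `σ₀ : S₀ → Y` along it
  let J : Y.IdealSheafData := ∏ i, Jc i
  have hJ : J ≠ ⊥ := YardstickModel.prod_ne_bot Finset.univ Jc fun i _ => hJc i
  obtain ⟨S₀, σ₀, hσ₀⟩ := exists_isBlowup Y J
  -- the yardsticks `R i` are regular integral `K`-schemes of finite type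
  haveI : ∀ i, IsNoetherianRing Γ(Y, U i) := fun i =>
    IsLocallyNoetherian.component_noetherian ⟨U i, hU i⟩
  have hint : ∀ i, IsIntegral (affineBlowup (I i)) := fun i => affineBlowup.isIntegral (hI i)
  let fR : ∀ i, affineBlowup (I i) ⟶ Spec (.of K) := fun i => affineBlowup.π (I i) ≫ φ i ≫ f
  have hft : ∀ i, LocallyOfFiniteType (fR i) := fun i => inferInstance
  have hqc : ∀ i, QuasiCompact (fR i) := fun i => inferInstance
  -- on the join every extended centre becomes an effective Cartier divisor (Stacks 07ZV)
  have hcart : ∀ i, IsEffectiveCartier ((Jc i).comap σ₀) := fun i => by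
    have hJi : J = Jc i * ∏ j ∈ Finset.univ.erase i, Jc j :=
      (Finset.mul_prod_erase Finset.univ Jc (Finset.mem_univ i)).symm
    have h1 : IsEffectiveCartier (J.comap σ₀) := hσ₀.isEffectiveCartier
    rw [hJi, comap_mul] at h1
    exact h1.of_mul_left
  refine ⟨n, fun i => Spec Γ(Y, U i), fun i => affineBlowup (I i), φ, fun i => inferInstance,
    fun i => affineBlowup.π (I i), 𝓘, fR, hint, hft, hqc, S₀, σ₀, J, fun y => ?_,
    fun i => affineBlowup.isBlowup (I i), hreg, hJ, hσ₀, hcart⟩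
  -- the charts cover `Y`
  obtain ⟨i, hi⟩ := hcover y
  refine ⟨i, ?_⟩
  change y ∈ Set.range (hU i).fromSpec
  rw [(hU i).range_fromSpec]
  exact hi

end Summit.ResolutionOfSingularities.ResolutionOfSingularities.Theorems.AffineToGlobal.YardstickChartsWeak

end
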